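import Literature.Computability.AlgebraicComplexity.OrbitClosureInheritance
import HarnessLib

/-!
# The padded permanent lives in `n² + 1` variables: inheritance for `X₀₀^{m-n} per_n`

Topic `Computability/AlgebraicComplexity` (geometric complexity theory). Instance of the
inheritance theorem `OrbitClosureInheritance.lean` (Bürgisser–Landsberg–Manivel–Weyman, SIAM J.
Comput. 40 (2011), Prop. 6.3.2) for the tree's padded permanent
`paddedPerFormLex k n m = X₀₀^{m-n} · per_n(bottom-right n × n block)` in the `m²` lexicographically
ordered matrix variables `MatIdx m` (`SchurWeylPlethysm.lean`, `OrbitClosure.lean`). BLMW, end of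
§6.3: "Applying Proposition 6.3.2 to `x = ℓ^{n-m} perm_m ∈ S^n ℂ^{m²+1} = W' ⊂ W = ℂ^{n²}` reduces the
problem of determining `ℂ[\overline{GL(W)·ℓ^{n-m}perm_m}]` to determining
`ℂ[\overline{GL(W')·ℓ^{n-m}perm_m}]`" (their `m, n` are the tree's `n, m`).

* `paddedPerSmall k n m ∈ k[X_0, …, X_{n²}]`: the same polynomial in its own `n² + 1` variables,
  `X_0^{m-n} · per_n(X_1, …, X_{n²})` (row-major `finProdFinEquiv`, shifted by one);
* `paddedPerEmb n m : Fin (n²+1) → MatIdx m`: the placement `0 ↦ (0,0)`,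
  `1 + (i n + j) ↦ (m-n+i, m-n+j)`; injective for `n < m` (`paddedPerEmb_injective`);
* `rename_paddedPerEmb_paddedPerSmall`: `paddedPerFormLex k n m = rename (paddedPerEmb n m) (paddedPerSmall k n m)`;
* `orbitMultiplicity_paddedPerFormLex_eq_paddedPerSmall` (characteristic zero, `n < m`): for every
  partition `λ` with `ℓ(λ) ≤ n² + 1`,
  `mult_{λ^*} k[Δ_m(X₀₀^{m-n} per_n)] (GL_{m²}) = mult_{λ^*} k[Δ_m(paddedPerSmall)] (GL_{n²+1})`,
  the left weight being the tree's `(Weight.dualOfPartition (m*m) λ).toMatIdx` (as in every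
  per/det multiplicity statement of the tree), the right one `Weight.dualOfPartition (n*n+1) λ`;
  `hasHighestWeight_paddedPerOrbitRep_iff_paddedPerSmall`: occurrence form.
  (Types with `ℓ(λ) > n² + 1` do not occur at all: the tree's BIP Thm. 4.9(1),
  `exists_partition_of_hasHighestWeight_paddedPerOrbitRep_holds`, or
  `orbitMultiplicity_rename_eq` of `OrbitClosureInheritance.lean`.)

For the GCT multiplicity-obstruction engine (cell `pub-gct`, ENGINE.md §1.5: "ALL perm-side work
for `n = 3` lives in `GL_10` (`GL_9` when `m = 3`), whatever `m` is"). Honest framing of that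
cell: rung-1 multiplicity-obstruction search for permanent versus determinant at small `(n, m)`;
no claim about VP ≠ VNP or P ≠ NP. No named facts.

## References

* [BurgisserEtAl2011] BLMW, SIAM J. Comput. 40(4) (2011), §6.3, Prop. 6.3.2 and the paragraph
  following its proof (arXiv:0907.2850v3 TeX ll. 1606–1645).
* [MulmuleySohoni2001] K. Mulmuley, M. Sohoni, SIAM J. Comput. 31 (2001), §4 (padded permanent).
-/

noncomputable section

open MvPolynomial

namespace Literature.Computability.AlgebraicComplexity

open _root_.Literature.NumberTheory.DiophantineGeometry

variable (k : Type*) [Field k]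

/-- **The padded permanent in its own `n² + 1` variables**: `X_0^{m-n} · per_n(X_1, …, X_{n²})`,
the `(i,j)` entry of the `n × n` matrix being the variable `1 + (i n + j)` (`Fin.succ ∘ finProdFinEquiv`).
Mulmuley–Sohoni 2001 §4; BLMW 2011 §6.3 (`ℓ^{n-m} perm_m ∈ S^n ℂ^{m²+1}`).
[cite: BurgisserEtAl2011, §6.3 (after Prop. 6.3.2)] -/
def paddedPerSmall (n m : ℕ) : MvPolynomial (Fin (n * n + 1)) k :=
  X 0 ^ (m - n) * rename (fun ij : Fin n × Fin n => Fin.succ (finProdFinEquiv ij)) (perPoly (Fin n) k)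

variable {k}

/-- The embedding of the `n × n` block into the bottom-right corner of `Fin m`: `i ↦ m - n + i`
(for `n ≤ m`; the tree's `BlockIdx n m`). [folklore] -/
def blockEmb {n m : ℕ} (hnm : n ≤ m) (i : Fin n) : Fin m :=
  ⟨m - n + i, by have := i.isLt; omega⟩

/-- Values of `blockEmb`. [folklore] -/
@[simp]
theorem blockEmb_val {n m : ℕ} (hnm : n ≤ m) (i : Fin n) : (blockEmb hnm i : ℕ) = m - n + i := rfl

/-- `blockEmb` is injective. [folklore] -/
theorem blockEmb_injective {n m : ℕ} (hnm : n ≤ m) : Function.Injective (blockEmb hnm) := by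
  intro i j h
  have h' := congrArg Fin.val h
  simp only [blockEmb_val] at h'
  exact Fin.ext (by omega)

/-- `blockEmb` as a bijection onto the tree's `BlockIdx n m = {i : Fin m // m - n ≤ i}`. [folklore] -/
def blockEquiv {n m : ℕ} (hnm : n ≤ m) : Fin n ≃ BlockIdx n m where
  toFun i := ⟨blockEmb hnm i, by simp⟩
  invFun j := ⟨(j.1 : ℕ) - (m - n), by have := j.1.isLt; have := j.2; omega⟩
  left_inv i := Fin.ext (by simp)
  right_inv j := Subtype.ext (Fin.ext (by have := j.2; simp only [blockEmb_val]; omega))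

/-- **The placement of the `n² + 1` variables among the `m²` matrix entries**: `0 ↦ (0,0)` (the
padding variable) and `1 + (i n + j) ↦ (m-n+i, m-n+j)` (the bottom-right block), in the
lexicographic letter type `MatIdx m`. [cite: BurgisserEtAl2011, §6.3 (after Prop. 6.3.2)] -/
def paddedPerEmb (n m : ℕ) [NeZero m] (hnm : n ≤ m) : Fin (n * n + 1) → MatIdx m :=
  Fin.cases (toLex ((0 : Fin m), (0 : Fin m)))
    fun t => toLex (blockEmb hnm (finProdFinEquiv.symm t).1, blockEmb hnm (finProdFinEquiv.symm t).2)

/-- `paddedPerEmb` at the padding variable. [folklore] -/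
@[simp]
theorem paddedPerEmb_zero (n m : ℕ) [NeZero m] (hnm : n ≤ m) :
    paddedPerEmb n m hnm 0 = toLex ((0 : Fin m), (0 : Fin m)) :=
  rfl

/-- `paddedPerEmb` on the block variables. [folklore] -/
@[simp]
theorem paddedPerEmb_succ (n m : ℕ) [NeZero m] (hnm : n ≤ m) (t : Fin (n * n)) :
    paddedPerEmb n m hnm t.succ =
      toLex (blockEmb hnm (finProdFinEquiv.symm t).1, blockEmb hnm (finProdFinEquiv.symm t).2) :=
  rfl

/-- For `n < m` the padding position `(0,0)` is not in the block, so the placement is injective.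
[folklore] -/
theorem paddedPerEmb_injective {n m : ℕ} [NeZero m] (hnm : n < m) :
    Function.Injective (paddedPerEmb n m hnm.le) := by
  intro a b hab
  induction a using Fin.cases with
  | zero =>
    induction b using Fin.cases with
    | zero => rfl
    | succ t =>
      exfalso
      rw [paddedPerEmb_zero, paddedPerEmb_succ] at hab
      have h1 := congrArg (fun x : MatIdx m => ((ofLex x).1 : ℕ)) hab
      simp only [ofLex_toLex, blockEmb_val, Fin.val_zero] at h1
      omega
  | succ s =>
    induction b using Fin.cases with
    | zero =>
      exfalso
      rw [paddedPerEmb_zero, paddedPerEmb_succ] at hab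
      have h1 := congrArg (fun x : MatIdx m => ((ofLex x).1 : ℕ)) hab
      simp only [ofLex_toLex, blockEmb_val, Fin.val_zero] at h1
      omega
    | succ t =>
      rw [paddedPerEmb_succ, paddedPerEmb_succ] at hab
      have h1 := congrArg (fun x : MatIdx m => ofLex x) hab
      simp only [ofLex_toLex, Prod.mk.injEq] at h1
      have h2 : finProdFinEquiv.symm s = finProdFinEquiv.symm t :=
        Prod.ext (blockEmb_injective hnm.le h1.1) (blockEmb_injective hnm.le h1.2)
      rw [finProdFinEquiv.symm.injective h2]

/-- **The tree's padded permanent is the renamed small one**: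
`paddedPerFormLex k n m = rename (paddedPerEmb n m) (paddedPerSmall k n m)` (`n ≤ m`).
[cite: BurgisserEtAl2011, §6.3 (after Prop. 6.3.2)] -/
theorem rename_paddedPerEmb_paddedPerSmall (n m : ℕ) [NeZero m] (hnm : n ≤ m) :
    rename (paddedPerEmb n m hnm) (paddedPerSmall k n m) = paddedPerFormLex k n m := by
  rw [paddedPerSmall, paddedPerFormLex, paddedPerPoly, map_mul, map_pow, rename_X, paddedPerEmb_zero,
    map_mul, map_pow, rename_X, rename_rename, rename_rename,
    ← rename_perPoly_equiv (k := k) (blockEquiv hnm), rename_rename]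
  congr 1
  refine congrArg (fun φ : Fin n × Fin n → MatIdx m => rename φ (perPoly (Fin n) k)) ?_
  funext ij
  rw [Function.comp_apply, paddedPerEmb_succ, Equiv.symm_apply_apply]
  rfl

/-- **Inheritance for the padded permanent (BLMW 2011 Prop. 6.3.2 applied as at the end of
§6.3).** For `n < m`, characteristic zero and every partition `λ` with `ℓ(λ) ≤ n² + 1`, the
multiplicity of the type `λ^*` (the tree's `(Weight.dualOfPartition (m*m) λ).toMatIdx`) in the
coordinate ring `k[Δ_m(X₀₀^{m-n} per_n)]` of the `GL_{m²}`-orbit closure of the padded permanent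
equals the multiplicity of `λ^*` in the coordinate ring of the `GL_{n²+1}`-orbit closure of the
same polynomial in its own `n² + 1` variables. [cite: BurgisserEtAl2011, Prop. 6.3.2] -/
theorem orbitMultiplicity_paddedPerFormLex_eq_paddedPerSmall [CharZero k] {n m : ℕ} [NeZero m]
    (hnm : n < m) {D : ℕ} (lam : Nat.Partition D) (hlam : lam.parts.card ≤ n * n + 1) :
    orbitMultiplicity k (paddedPerFormLex k n m) m (Weight.dualOfPartition (m * m) lam).toMatIdx =
      orbitMultiplicity k (paddedPerSmall k n m) m (Weight.dualOfPartition (n * n + 1) lam) := by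
  rw [← rename_paddedPerEmb_paddedPerSmall n m hnm.le]
  exact orbitMultiplicity_rename_dualOfPartition_of_injective (matIdxEquiv m) _
    (paddedPerEmb_injective hnm) _ (NeZero.ne m) lam hlam

/-- Occurrence form: for `n < m`, `ℓ(λ) ≤ n² + 1`, characteristic zero, the type `λ^*` occurs in
`k[Δ_m(X₀₀^{m-n} per_n)]` (the tree's `paddedPerOrbitRep k n m`) iff it occurs in the coordinate
ring of the `GL_{n²+1}`-orbit closure of `paddedPerSmall k n m`. [cite: BurgisserEtAl2011, Prop. 6.3.2] -/
theorem hasHighestWeight_paddedPerOrbitRep_iff_paddedPerSmall [CharZero k] {n m : ℕ} [NeZero m]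
    (hnm : n < m) {D : ℕ} (lam : Nat.Partition D) (hlam : lam.parts.card ≤ n * n + 1) :
    HasHighestWeight (paddedPerOrbitRep k n m) (Weight.dualOfPartition (m * m) lam).toMatIdx ↔
      HasHighestWeight (orbitCoordRep (paddedPerSmall k n m) m)
        (Weight.dualOfPartition (n * n + 1) lam) := by
  rw [paddedPerOrbitRep, ← rename_paddedPerEmb_paddedPerSmall n m hnm.le]
  exact hasHighestWeight_orbitCoordRep_rename_dualOfPartition_iff (matIdxEquiv m) _
    (paddedPerEmb_injective hnm) _ (NeZero.ne m) lam hlam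

end Literature.Computability.AlgebraicComplexity
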